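import Literature.Analysis.FunctionSpaces.TorusTrigPoly
import Mathlib.Algebra.FiniteSupport.Basic
import Mathlib.Topology.Algebra.InfiniteSum.Real
import HarnessLib

/-!
# Fourier transform of finitely supported real families on `ℤ^d`: Plancherel, shifts, and the
Dirichlet energy as `∫ μ |T̂|²`

Support file (module "P1") for the lattice potential theory of the four-dimensional `U(1)` gauge
theory (proof programme of the named fact
`Literature.MathematicalPhysics.QuantumFieldTheory.FrohlichSpencerU1PerimeterLawD4`;
Fröhlich–Spencer 1982 §2.5/§2.10: the lattice Green's function and the Coulomb energy
`(ε_Λ, ε_Λ) ≤ const (L+T)` of (2.88), which we bound variationally — `CubicalChainsPairing` —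
by a Fourier computation on the dual torus). Everything is proved; no named fact is introduced.

For a real family `T : ℤ^d → ℝ` supported in a finite set `S` of sites, its Fourier transform is
the trigonometric polynomial `latFT S T = ∑_{y ∈ S} T(y) e_y` on `UnitAddTorus (Fin d)` (the tree's
`Torus.trigPoly` with scalar coefficients; `e_y = mFourier y`). We prove

* `latFT_eq_of_support_subset` (independence of the ambient finite set);
* **Plancherel** `integral_norm_sq_latFT : ∫ ‖latFT S T‖² = ∑_{y∈S} T(y)²` and
  `integral_conj_latFT_mul_latFT : ∫ conj(latFT S T) · latFT S U = ∑_{y∈S} T(y) U(y)`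
  (`Torus.integral_norm_sq_trigPoly`, `Torus.integral_inner_trigPoly`, H21's global volume);
* **shifts** `latFT_comp_add : latFT S' (T(· + a)) = e_{-a} · latFT S T` and differences
  `latFT_sub_comp_add : (T(·+a) - T)^ = (e_{-a} - 1) T̂`;
* `norm_mFourier_neg_single_sub_one_sq : ‖e_{-eⱼ}(x) - 1‖² = ‖𝐞(xⱼ) - 1‖²` and the
  **Dirichlet energy in Fourier space** `sum_integral_norm_sq_latFT_diff :
  ∑ⱼ ∫ ‖(T(·+eⱼ) - T)^‖² = ∫ μ ‖T̂‖²` with `μ(x) = ∑ⱼ ‖𝐞(xⱼ) - 1‖²` the lattice dispersion;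
* the lattice-side identities `tsum_sq_diff_eq_integral` (`∑_y (T(y+eⱼ) - T(y))² = ∫ ‖(T(·+eⱼ) - T)^‖²`)
  and `tsum_mul_secondDiff` (**summation by parts for the lattice Laplacian**, one direction:
  `∑_y T(y) ((T(y) - T(y+eⱼ)) + (T(y) - T(y-eⱼ))) = ∑_y (T(y+eⱼ) - T(y))²`).

The identification `∑ⱼ ‖𝐞(xⱼ) - 1‖² = latticeDispersion x` (`LatticeDispersion.lean`) is definitional and is
used by the consumers; this file does not import it.

## References

* J. Fröhlich, T. Spencer, Comm. Math. Phys. 83 (1982) 411–454, §2.5 (2.32)–(2.36), §2.10 (2.88).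
  [FrohlichSpencerCMP1982]
* L. Grafakos, *Classical Fourier Analysis*, 3rd ed. (2014), Prop. 3.2.7 (3) (Parseval for finite
  sums of characters), as vendored in `TorusTrigPoly`. [Grafakos2014]
-/

noncomputable section

open MeasureTheory Set Filter Complex Finset Function
open scoped Real ENNReal ComplexConjugate

namespace Literature.Analysis.FunctionSpaces

namespace LatticeFourier

open Literature.Analysis.FunctionSpaces.Torus (trigPoly)

variable {d : ℕ}

/-- The unit lattice vector `eⱼ`. [folklore] -/
abbrev e (j : Fin d) : (Fin d → ℤ) := Pi.single j 1

/-! ### The Fourier transform of a finitely supported family -/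

/-- **The Fourier transform of a real lattice family supported in the finite set `S`**: the
trigonometric polynomial `T̂(x) = ∑_{y∈S} T(y) e_y(x)` on the dual torus. [folklore] -/
def latFT (S : Finset ((Fin d → ℤ))) (T : (Fin d → ℤ) → ℝ) : UnitAddTorus (Fin d) → ℂ :=
  trigPoly S fun y => (T y : ℂ)

/-- Unfolding. [folklore] -/
theorem latFT_apply (S : Finset ((Fin d → ℤ))) (T : (Fin d → ℤ) → ℝ) (x : UnitAddTorus (Fin d)) :
    latFT S T x = ∑ y ∈ S, UnitAddTorus.mFourier y x * (T y : ℂ) := by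
  simp [latFT, Torus.trigPoly_apply, smul_eq_mul]

/-- The Fourier transform only depends on the values of `T` (the ambient finite set may be
enlarged or shrunk as long as it contains the support). [folklore] -/
theorem latFT_eq_of_support_subset {S S' : Finset ((Fin d → ℤ))} {T : (Fin d → ℤ) → ℝ}
    (hS : Function.support T ⊆ S) (hS' : Function.support T ⊆ S') : latFT S T = latFT S' T := by
  classical
  funext x
  rw [latFT_apply, latFT_apply]
  have h1 : ∑ y ∈ S ∩ S', UnitAddTorus.mFourier y x * (T y : ℂ) =
      ∑ y ∈ S, UnitAddTorus.mFourier y x * (T y : ℂ) := by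
    refine Finset.sum_subset Finset.inter_subset_left fun y hyS hy => ?_
    have hT : T y = 0 := by
      by_contra hne
      exact hy (Finset.mem_inter.2 ⟨hyS, hS' (Function.mem_support.2 hne)⟩)
    simp [hT]
  have h2 : ∑ y ∈ S ∩ S', UnitAddTorus.mFourier y x * (T y : ℂ) =
      ∑ y ∈ S', UnitAddTorus.mFourier y x * (T y : ℂ) := by
    refine Finset.sum_subset Finset.inter_subset_right fun y hyS' hy => ?_
    have hT : T y = 0 := by
      by_contra hne
      exact hy (Finset.mem_inter.2 ⟨hS (Function.mem_support.2 hne), hyS'⟩)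
    simp [hT]
  rw [← h1, h2]

/-- `latFT` is continuous. [folklore] -/
theorem continuous_latFT (S : Finset ((Fin d → ℤ))) (T : (Fin d → ℤ) → ℝ) : Continuous (latFT S T) :=
  Torus.continuous_trigPoly S _

/-! ### Plancherel -/

/-- **Plancherel, norm form**: `∫ ‖T̂‖² = ∑_{y∈S} T(y)²`. [cite: Grafakos2014, Prop. 3.2.7 (3)] -/
theorem integral_norm_sq_latFT (S : Finset ((Fin d → ℤ))) (T : (Fin d → ℤ) → ℝ) :
    ∫ x, ‖latFT S T x‖ ^ 2 = ∑ y ∈ S, T y ^ 2 := by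
  rw [latFT, Torus.integral_norm_sq_trigPoly]
  refine Finset.sum_congr rfl fun y _ => ?_
  rw [Complex.norm_real, Real.norm_eq_abs, sq_abs]

/-- **Plancherel, bilinear form**: `∫ conj(T̂) Û = ∑_{y∈S} T(y) U(y)`. [cite: Grafakos2014, Prop. 3.2.7 (3)] -/
theorem integral_conj_latFT_mul_latFT (S : Finset ((Fin d → ℤ))) (T U : (Fin d → ℤ) → ℝ) :
    ∫ x, conj (latFT S T x) * latFT S U x = ((∑ y ∈ S, T y * U y : ℝ) : ℂ) := by
  have h := Torus.integral_inner_trigPoly S (fun y => (T y : ℂ)) (fun y => (U y : ℂ))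
  simp only [RCLike.inner_apply, Complex.conj_ofReal] at h
  calc ∫ x, conj (latFT S T x) * latFT S U x
      = ∫ x, trigPoly S (fun y => (U y : ℂ)) x * conj (trigPoly S (fun y => (T y : ℂ)) x) :=
        integral_congr_ae (ae_of_all _ fun x => mul_comm _ _)
    _ = ∑ y ∈ S, (U y : ℂ) * (T y : ℂ) := h
    _ = ((∑ y ∈ S, T y * U y : ℝ) : ℂ) := by
        push_cast
        exact Finset.sum_congr rfl fun y _ => mul_comm _ _

/-! ### Linearity and shifts -/

/-- `latFT` of a difference. [folklore] -/
theorem latFT_sub (S : Finset (Fin d → ℤ)) (T U : (Fin d → ℤ) → ℝ) :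
    latFT S (T - U) = latFT S T - latFT S U := by
  have h : (fun y => (((T - U) y : ℝ) : ℂ)) = (fun y => (T y : ℂ)) - fun y => (U y : ℂ) := by
    funext y; simp
  rw [latFT, h, Torus.trigPoly_sub]
  rfl

/-- **Fourier transform of a translate**: `(T(· + a))^ = e_{-a} · T̂`, with the translated family
read on the translated ambient set. [folklore] -/
theorem latFT_comp_add (S : Finset (Fin d → ℤ)) (T : (Fin d → ℤ) → ℝ) (a : Fin d → ℤ)
    (x : UnitAddTorus (Fin d)) :
    latFT (S.image fun y => y - a) (fun y => T (y + a)) x =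
      UnitAddTorus.mFourier (-a) x * latFT S T x := by
  classical
  rw [latFT_apply, latFT_apply, Finset.sum_image fun y _ y' _ h => sub_left_injective h,
    Finset.mul_sum]
  refine Finset.sum_congr rfl fun y _ => ?_
  rw [sub_add_cancel]
  simp only [sub_eq_neg_add, UnitAddTorus.mFourier_add]
  ring

/-- The support of a translate. [folklore] -/
theorem support_comp_add_subset {S : Finset (Fin d → ℤ)} {T : (Fin d → ℤ) → ℝ}
    (hS : Function.support T ⊆ S) (a : Fin d → ℤ) :
    Function.support (fun y => T (y + a)) ⊆ (S.image fun y => y - a : Finset (Fin d → ℤ)) := by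
  classical
  intro y hy
  simp only [Function.mem_support, ne_eq] at hy
  simp only [Finset.coe_image, Set.mem_image, Finset.mem_coe]
  exact ⟨y + a, hS (Function.mem_support.2 hy), add_sub_cancel_right y a⟩

/-- **Fourier transform of a difference `T(·+a) - T`**: `(e_{-a} - 1) · T̂`, on any ambient finite
set containing both supports. [folklore] -/
theorem latFT_diff (S S' : Finset (Fin d → ℤ)) {T : (Fin d → ℤ) → ℝ} (hS : Function.support T ⊆ S)
    (a : Fin d → ℤ) (hS'₁ : Function.support T ⊆ S')
    (hS'₂ : Function.support (fun y => T (y + a)) ⊆ S') (x : UnitAddTorus (Fin d)) :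
    latFT S' (fun y => T (y + a) - T y) x = (UnitAddTorus.mFourier (-a) x - 1) * latFT S T x := by
  classical
  have h1 : latFT S' (fun y => T (y + a) - T y) = latFT S' (fun y => T (y + a)) - latFT S' T :=
    latFT_sub S' (fun y => T (y + a)) T
  have h2 : latFT S' (fun y => T (y + a)) = latFT (S.image fun y => y - a) (fun y => T (y + a)) :=
    latFT_eq_of_support_subset hS'₂ (support_comp_add_subset hS a)
  have h3 : latFT S' T = latFT S T := latFT_eq_of_support_subset hS'₁ hS
  rw [h1, Pi.sub_apply, h2, h3, latFT_comp_add, sub_mul, one_mul]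

/-! ### The dispersion factor -/

/-- `‖e_{-eⱼ}(x) - 1‖ = ‖𝐞(xⱼ) - 1‖`. [folklore] -/
theorem norm_mFourier_neg_single_sub_one (j : Fin d) (x : UnitAddTorus (Fin d)) :
    ‖UnitAddTorus.mFourier (-e j) x - 1‖ = ‖(fourier 1 (x j) : ℂ) - 1‖ := by
  classical
  rw [UnitAddTorus.mFourier_neg, UnitAddTorus.mFourier_single]
  rw [← Complex.norm_conj (((fourier 1 (x j) : ℂ)) - 1), map_sub, map_one]

/-- **The Dirichlet energy of one difference in Fourier space**:
`∫ ‖(T(·+eⱼ) - T)^‖² = ∫ ‖𝐞(xⱼ) - 1‖² ‖T̂‖²`. [folklore] -/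
theorem integral_norm_sq_latFT_diff (S S' : Finset (Fin d → ℤ)) {T : (Fin d → ℤ) → ℝ}
    (hS : Function.support T ⊆ S) (j : Fin d) (hS'₁ : Function.support T ⊆ S')
    (hS'₂ : Function.support (fun y => T (y + e j)) ⊆ S') :
    ∫ x, ‖latFT S' (fun y => T (y + e j) - T y) x‖ ^ 2 =
      ∫ x, ‖(fourier 1 (x j) : ℂ) - 1‖ ^ 2 * ‖latFT S T x‖ ^ 2 := by
  refine integral_congr_ae (ae_of_all _ fun x => ?_)
  simp only
  rw [latFT_diff S S' hS (e j) hS'₁ hS'₂, norm_mul, mul_pow, norm_mFourier_neg_single_sub_one]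

/-- **The Dirichlet energy in Fourier space**: `∑ⱼ ∫ ‖(T(·+eⱼ) - T)^‖² = ∫ μ ‖T̂‖²` with
`μ(x) = ∑ⱼ ‖𝐞(xⱼ) - 1‖²` the lattice dispersion (`LatticeDispersion.latticeDispersion`). [folklore] -/
theorem sum_integral_norm_sq_latFT_diff (S : Finset (Fin d → ℤ)) (S' : Fin d → Finset (Fin d → ℤ))
    {T : (Fin d → ℤ) → ℝ} (hS : Function.support T ⊆ S) (hS'₁ : ∀ j, Function.support T ⊆ S' j)
    (hS'₂ : ∀ j, Function.support (fun y => T (y + e j)) ⊆ S' j) :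
    ∑ j, ∫ x, ‖latFT (S' j) (fun y => T (y + e j) - T y) x‖ ^ 2 =
      ∫ x, (∑ j, ‖(fourier 1 (x j) : ℂ) - 1‖ ^ 2) * ‖latFT S T x‖ ^ 2 := by
  have hint : ∀ j, Integrable (fun x : UnitAddTorus (Fin d) =>
      ‖(fourier 1 (x j) : ℂ) - 1‖ ^ 2 * ‖latFT S T x‖ ^ 2) volume := fun j =>
    (((continuous_norm.comp (((fourier 1).continuous.comp (continuous_apply j)).sub
      continuous_const)).pow 2).mul ((continuous_norm.comp (continuous_latFT S T)).pow 2)).integrable_unitAddTorus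
  simp_rw [integral_norm_sq_latFT_diff S (S' _) hS _ (hS'₁ _) (hS'₂ _)]
  rw [← integral_finsetSum _ fun j _ => hint j]
  refine integral_congr_ae (ae_of_all _ fun x => ?_)
  simp only [Finset.sum_mul]

/-! ### Lattice side: energies as sums of squared differences -/

/-- A site sum of a family supported in a finite set is the finite sum. [folklore] -/
theorem tsum_eq_sum_of_support_subset {S : Finset (Fin d → ℤ)} {F : (Fin d → ℤ) → ℝ}
    (hS : Function.support F ⊆ S) : ∑' y, F y = ∑ y ∈ S, F y :=
  tsum_eq_sum fun y hy => by
    by_contra hne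
    exact hy (hS (Function.mem_support.2 hne))

/-- **Plancherel for the squared differences**: `∑_y (T(y+eⱼ) - T(y))² = ∫ ‖(T(·+eⱼ) - T)^‖²`.
[cite: Grafakos2014, Prop. 3.2.7 (3)] -/
theorem tsum_sq_diff_eq_integral (S' : Finset (Fin d → ℤ)) {T : (Fin d → ℤ) → ℝ} (j : Fin d)
    (hS'₁ : Function.support T ⊆ S') (hS'₂ : Function.support (fun y => T (y + e j)) ⊆ S') :
    ∑' y, (T (y + e j) - T y) ^ 2 = ∫ x, ‖latFT S' (fun y => T (y + e j) - T y) x‖ ^ 2 := by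
  rw [integral_norm_sq_latFT]
  refine tsum_eq_sum_of_support_subset fun y hy => ?_
  simp only [Function.mem_support, ne_eq, pow_eq_zero_iff, OfNat.ofNat_ne_zero, not_false_eq_true,
    sub_eq_zero] at hy
  by_contra hyS
  have h1 : T y = 0 := by
    by_contra hne; exact hyS (hS'₁ (Function.mem_support.2 hne))
  have h2 : T (y + e j) = 0 := by
    by_contra hne; exact hyS (hS'₂ (Function.mem_support.2 (by simpa using hne)))
  exact hy (by rw [h1, h2])

/-- **Summation by parts for the lattice Laplacian**: for a finitely supported real family,
`∑_y T(y) (2T(y) - T(y+eⱼ) - T(y-eⱼ)) = ∑_y (T(y+eⱼ) - T(y))²`. [cite: FrohlichSpencerCMP1982, §2.3 (2.15)] -/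
theorem tsum_mul_secondDiff (T : (Fin d → ℤ) → ℝ) (hT : HasFiniteSupport T) (j : Fin d) :
    ∑' y, T y * ((T y - T (y + e j)) + (T y - T (y - e j))) = ∑' y, (T (y + e j) - T y) ^ 2 := by
  have hshift : HasFiniteSupport fun y => T (y + e j) := by
    have : Function.support (fun y => T (y + e j)) = (fun y => y + e j) ⁻¹' Function.support T := by
      ext y; simp
    rw [HasFiniteSupport, this]
    exact hT.preimage fun y _ y' _ h => add_right_cancel h
  have hA : HasFiniteSupport fun y => T y * (T y - T (y + e j)) :=
    hT.subset (Function.support_mul_subset_left _ _)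
  have hB : HasFiniteSupport fun y => T y * (T y - T (y - e j)) :=
    hT.subset (Function.support_mul_subset_left _ _)
  have hB' : HasFiniteSupport fun y => T (y + e j) * (T (y + e j) - T y) :=
    hshift.subset (Function.support_mul_subset_left _ _)
  have h1 : ∑' y, T y * (T y - T (y - e j)) = ∑' y, T (y + e j) * (T (y + e j) - T y) := by
    rw [← (Equiv.addRight (e j)).tsum_eq (fun y => T y * (T y - T (y - e j)))]
    refine tsum_congr fun y => ?_
    simp [add_sub_cancel_right]
  calc ∑' y, T y * ((T y - T (y + e j)) + (T y - T (y - e j)))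
      = ∑' y, (T y * (T y - T (y + e j)) + T y * (T y - T (y - e j))) := by simp only [mul_add]
    _ = ∑' y, T y * (T y - T (y + e j)) + ∑' y, T y * (T y - T (y - e j)) :=
        Summable.tsum_add (summable_of_hasFiniteSupport hA) (summable_of_hasFiniteSupport hB)
    _ = ∑' y, T y * (T y - T (y + e j)) + ∑' y, T (y + e j) * (T (y + e j) - T y) := by rw [h1]
    _ = ∑' y, (T y * (T y - T (y + e j)) + T (y + e j) * (T (y + e j) - T y)) :=
        (Summable.tsum_add (summable_of_hasFiniteSupport hA) (summable_of_hasFiniteSupport hB')).symm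
    _ = ∑' y, (T (y + e j) - T y) ^ 2 := tsum_congr fun y => by ring

end LatticeFourier

end Literature.Analysis.FunctionSpaces
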